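import Mathlib
import HarnessLib
import Summits.CriticalPhenomena.SAWScalingLimit.Theses.SAWLoopFugacityFlow
import Literature.Probability.RandomPlanarGeometry.SLE
import Literature.Probability.RandomPlanarGeometry.ConformalRestrictionProofs
import Literature.Probability.RandomPlanarGeometry.CritPercSLESimplePathHolds
import Literature.Probability.RandomPlanarGeometry.CaratheodoryHalfPlaneProofs
import Literature.Probability.RandomPlanarGeometry.LocalMartingaleProofs
import Literature.Probability.RandomPlanarGeometry.SimpleCurves

/-!
# `SLECarrier` (route SAWLoopFugacityFlow, item stmt-CriticalPhenomena-4985) — proved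

The chordal SLE_(8/3) law of a Dobrushin domain `(D; a, b)` is a probability measure carried by
simple curve classes running from `a` to `b`, with trace in `closure D` and meeting `∂D` only
inside `{a, b}`.  Assembly of tree theorems:

* `IsSLELaw.isProbabilityMeasure` (push-forward of the pre-Wiener probability measure; the
  `Fact isProjectiveLimit_preWienerMeasure` instance is supplied by
  `isProjectiveLimit_preWienerMeasure_holds`, Kolmogorov extension);
* `IsSLELaw.ae_simple` fed with Rohde–Schramm Thm. 6.1 (`ae_isSimpleTrace_sleTrace_of_le_four_holds`,
  valid since `0 < 8/3 ≤ 4`) and Borel measurability of the simple classes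
  (`CurveClass.measurableSet_simple_holds`);
* `IsSLELaw.ae_endpoints` fed with Carathéodory's theorem in half-plane form
  (`JordanDomain.mapsTo_boundaryExtension_holds`).

References: S. Rohde, O. Schramm, *Basic properties of SLE*, Ann. of Math. 161 (2005), Thm. 6.1;
G. F. Lawler, *Conformally Invariant Processes in the Plane* (2005), §6.3.
-/

noncomputable section

open MeasureTheory
open scoped NNReal

namespace Summit.CriticalPhenomena.SAWScalingLimit.Theorems

open Literature.Probability.RandomPlanarGeometry

/-- **`SLECarrier` holds** (item stmt-CriticalPhenomena-4985): for every Dobrushin domain `D` and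
every chordal SLE_(8/3) law `μ` in `D`, `μ` is a probability measure and `μ`-a.e. curve class is
simple, runs from `D.pt 0` to `D.pt 1`, has range in `closure D.carrier`, and meets
`frontier D.carrier` only inside `{D.pt 0, D.pt 1}`.  Rohde–Schramm (2005) Thm. 6.1 (simplicity for
`κ ≤ 4`) and Lawler (2005) §6.3, through the tree theorems `IsSLELaw.isProbabilityMeasure`,
`IsSLELaw.ae_simple`, `IsSLELaw.ae_endpoints` and the discharged named facts. -/
theorem SLECarrier_proof :
    Summit.CriticalPhenomena.SAWScalingLimit.Theses.SAWLoopFugacityFlow.SLECarrier := by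
  unfold Summit.CriticalPhenomena.SAWScalingLimit.Theses.SAWLoopFugacityFlow.SLECarrier
  intro D μ hμ
  haveI : Fact Literature.Probability.Process.isProjectiveLimit_preWienerMeasure :=
    ⟨isProjectiveLimit_preWienerMeasure_holds⟩
  have h0 : (0 : ℝ≥0) < (8 : ℝ≥0) / 3 := by positivity
  have h4 : (8 : ℝ≥0) / 3 ≤ 4 := by
    rw [div_le_iff₀ (by norm_num : (0 : ℝ≥0) < 3)]
    norm_num
  refine ⟨hμ.isProbabilityMeasure, ?_⟩
  filter_upwards [hμ.ae_simple ae_isSimpleTrace_sleTrace_of_le_four_holds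
      CurveClass.measurableSet_simple_holds h0 h4,
    hμ.ae_endpoints JordanDomain.mapsTo_boundaryExtension_holds] with γ hs he
  exact ⟨hs.1, he.1, he.2.1, he.2.2, hs.2⟩

end Summit.CriticalPhenomena.SAWScalingLimit.Theorems

end
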